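import Summits.CriticalPhenomena.PercolationContinuityZ3.Theorems.BoundaryTwoArmDecay.Negative.OneArmLowerBound
import Literature.Probability.Percolation.FiniteEnergy
import Literature.Probability.Percolation.InequalitiesProofs

/-!
# `BoundaryTwoArmDecay` (crux stmt-CriticalPhenomena-0911, route `PercLowPointHalfSpace`):
# load-bearing analysis (negative-side support, refuter cdisprove seat)

Everything here is `sorry`-free and asserts NO route statement positively.  With
`E r = {arm_H(0,r) ∧ arm_H(e,r) ∧ 0 ↮_H e}` the verbatim event of the crux (`boundaryTwoArmDecay_iff`):

* `boundaryTwoArmDecay_false_without_r_ge_one` — the guard `1 ≤ r` is load-bearing (formalisation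
  boundary: `Real.rpow` gives `0^{-(5/2+κ)} = 0` while `P(E 0) = P(0 ↮_H e) ≥ (1 - p_c)^6 > 0`).
* `boundaryTwoArmDecayWithoutKappaPos_trivial` — without `0 < κ` the bound is trivial (`κ = -5/2, C = 1`).
* `boundaryTwoArmDecay_false_without_disjoint` — the disjointness clause `0 ↮_H e` is load-bearing: with it
  dropped, `P(both arms) ≥ p_c · P(armBox (r+1)) ≥ p_c / (36 (2r+3)²)` (Harris–FKG and
  `OneArmLowerBound.armBox_ge`), which is not `O(r^{-5/2-κ})` for any `κ > 0`.  Any proof of the crux must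
  therefore use the repulsion of the two DISJOINT clusters at the wall quantitatively (BK alone gives
  `2·x_s ≈ 1.95 < 5/2` numerically).

References: Grimmett, Percolation (1999) §1.4 (0 < p_c < 1), Thm 2.4 (Harris–FKG) [Grimmett1999].
-/
namespace Summit.CriticalPhenomena.PercolationContinuityZ3.Theorems.BoundaryTwoArmDecay.Negative

open MeasureTheory ProbabilityTheory Filter Topology
open Literature.Probability.Percolation Literature.Probability.LatticeModels
open Literature.Probability.Percolation.DCT16
open Summit.CriticalPhenomena.PercolationContinuityZ3.Theses.PercLowPointHalfSpace

noncomputable section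
/-- The crux event at scale `r`: both half-space clusters of `0` and `e` reach sup-distance `r`
and are disjoint (verbatim the set-builder of the route decl). -/
def E (r : ℕ) : Set (BondConfig (Site 3)) :=
  {ω | (∃ y : Site 3, (∃ i : Fin 3, (r : ℤ) ≤ |y i|) ∧ ω ∈ openConnIn H 0 y) ∧
    (∃ y : Site 3, (∃ i : Fin 3, (r : ℤ) ≤ |y i - e i|) ∧ ω ∈ openConnIn H e y) ∧
    ω ∉ openConnIn H 0 e}

/-- The route decl, restated through `E` (definitional). -/
theorem boundaryTwoArmDecay_iff :
    BoundaryTwoArmDecay ↔ ∃ κ C : ℝ, 0 < κ ∧ ∀ r : ℕ, 1 ≤ r → μ.real (E r) ≤ C * (r : ℝ) ^ (-(5 / 2 + κ)) :=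
  Iff.rfl

/-! ## (a) Load-bearing analysis -/

/-- The six edges of `ℤ³` at the origin. -/
def starEdges : Finset (Sym2 (Site 3)) :=
  Finset.univ.image (fun i : Fin 3 => s((0 : Site 3), Pi.single i 1)) ∪
    Finset.univ.image (fun i : Fin 3 => s((0 : Site 3), -Pi.single i 1))

/-- If all six edges at the origin are closed and `ω` only uses lattice edges, then `0` is joined to
nothing inside `H`: in particular `ω ∉ openConnIn H 0 e`. -/
theorem not_openConnIn_of_star_closed {ω : BondConfig (Site 3)} (hω : ω ⊆ (zdGraph 3).edgeSet)
    (hc : ∀ f ∈ starEdges, f ∉ ω) {y : Site 3} (hy : y ≠ 0) : ω ∉ openConnIn H 0 y := by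
  rintro ⟨h0, hyH, hreach⟩
  -- generalise the endpoints and induct on a walk
  suffices key : ∀ (a b : H), ((openGraph ω).induce H).Reachable a b → a.1 = 0 → b.1 = 0 by
    exact hy (key ⟨0, h0⟩ ⟨y, hyH⟩ hreach rfl)
  intro a b hab ha
  obtain ⟨p⟩ := hab
  induction p with
  | nil => exact ha
  | @cons u v w hadj q ih =>
    exfalso
    have hadj' : (openGraph ω).Adj u.1 v.1 := hadj
    rw [openGraph_adj] at hadj'
    obtain ⟨hmem, hne⟩ := hadj'
    rw [ha] at hmem hne
    have hedge : (zdGraph 3).Adj 0 v.1 := by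
      simpa [SimpleGraph.mem_edgeSet] using hω hmem
    obtain ⟨i, hv | hv⟩ := (zdGraph_adj_iff 0 v.1).1 hedge
    · apply hc _ _ hmem
      rw [hv, zero_add]
      exact Finset.mem_union.2 (Or.inl (Finset.mem_image_of_mem _ (Finset.mem_univ i)))
    · apply hc _ _ hmem
      have : v.1 = -Pi.single i 1 := eq_neg_of_add_eq_zero_left hv.symm
      rw [this]
      exact Finset.mem_union.2 (Or.inr (Finset.mem_image_of_mem _ (Finset.mem_univ i)))

/-- `{all six edges at 0 closed} ∩ {ω ⊆ E(ℤ³)} ⊆ E 0`. -/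
theorem star_closed_subset_E_zero :
    {ω : BondConfig (Site 3) | ∀ f ∈ starEdges, f ∉ ω} ∩ {ω | ω ⊆ (zdGraph 3).edgeSet} ⊆ E 0 := by
  rintro ω ⟨hc, hω⟩
  have h0 : (0 : Site 3) ∈ H := by simp [H]
  have he : e ∈ H := by simp [H, e]
  refine ⟨⟨0, ⟨0, by simp⟩, h0, h0, SimpleGraph.Reachable.refl _⟩,
    ⟨e, ⟨0, by simp [e]⟩, he, he, SimpleGraph.Reachable.refl _⟩, ?_⟩
  have hne : e ≠ 0 := by
    intro h
    have := congr_fun h 1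
    simp [e] at this
  exact not_openConnIn_of_star_closed hω hc hne

/-- `P_{p_c}(E 0) > 0`: with probability at least `(1 - p_c)^6 > 0` the six edges at the origin are closed
(`p_c(ℤ³) < 1`, Grimmett 1999 §1.4, in tree), and then `E 0` holds. -/
theorem measureReal_E_zero_pos : 0 < μ.real (E 0) := by
  have hpc : ((criticalProbI 3 : unitInterval) : ℝ) < 1 := by
    rw [coe_criticalProbI]
    exact (Grimmett1999_criticalProb_pos_lt_one_holds 3 (by norm_num)).2
  have h1 : (1 - ((criticalProbI 3 : unitInterval) : ℝ)) ^ starEdges.card ≤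
      μ.real {ω | ∀ f ∈ starEdges, f ∉ ω} :=
    le_bondPercolation_real_forall_notMem (zdGraph 3) (criticalProbI 3) starEdges
  have h2 : 0 < (1 - ((criticalProbI 3 : unitInterval) : ℝ)) ^ starEdges.card :=
    pow_pos (sub_pos.2 hpc) _
  have hA : {ω : BondConfig (Site 3) | ω ⊆ (zdGraph 3).edgeSet} =ᵐ[μ] Set.univ :=
    Filter.eventuallyEq_univ.2 setBernoulli_ae_subset
  have h3 : μ.real ({ω : BondConfig (Site 3) | ∀ f ∈ starEdges, f ∉ ω} ∩ {ω | ω ⊆ (zdGraph 3).edgeSet})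
      = μ.real {ω : BondConfig (Site 3) | ∀ f ∈ starEdges, f ∉ ω} :=
    measureReal_congr (inter_ae_eq_left_of_ae_eq_univ hA)
  have h4 : μ.real ({ω : BondConfig (Site 3) | ∀ f ∈ starEdges, f ∉ ω} ∩ {ω | ω ⊆ (zdGraph 3).edgeSet})
      ≤ μ.real (E 0) := measureReal_mono star_closed_subset_E_zero
  linarith

/-- **The guard `1 ≤ r` is load-bearing** (formalisation boundary): without it the crux is FALSE, because
at `r = 0` Mathlib's `Real.rpow` gives `(0:ℝ)^(-(5/2+κ)) = 0` while `P(E 0) = P(0 ↮_H e) > 0`.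
Any proof of A must therefore use `1 ≤ r` (if only to keep the right-hand side positive). -/
theorem boundaryTwoArmDecay_false_without_r_ge_one :
    ¬ (∃ κ C : ℝ, 0 < κ ∧ ∀ r : ℕ, μ.real (E r) ≤ C * (r : ℝ) ^ (-(5 / 2 + κ))) := by
  rintro ⟨κ, C, hκ, h⟩
  have h0 := h 0
  rw [Nat.cast_zero, Real.zero_rpow (by linarith), mul_zero] at h0
  exact absurd h0 (not_le.2 measureReal_E_zero_pos)

/-- **`0 < κ` is load-bearing** in the opposite direction: without it the crux is TRIVIAL
(`κ = -5/2`, `C = 1`, since probabilities are at most `1`). -/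
theorem boundaryTwoArmDecayWithoutKappaPos_trivial :
    ∃ κ C : ℝ, ∀ r : ℕ, 1 ≤ r → μ.real (E r) ≤ C * (r : ℝ) ^ (-(5 / 2 + κ)) := by
  refine ⟨-(5 / 2), 1, fun r _ => ?_⟩
  have : (-(5 / 2 + -(5 / 2 : ℝ))) = 0 := by norm_num
  rw [this, Real.rpow_zero, mul_one]
  exact measureReal_le_one

/-! ## (b) Monotonicity in `r` (information for provers: dyadic scales suffice) -/

/-- `E` is decreasing in `r`. -/
theorem E_antitone : Antitone E := by
  intro r s hrs ω hω
  obtain ⟨⟨y, ⟨i, hi⟩, hy⟩, ⟨y', ⟨i', hi'⟩, hy'⟩, hne⟩ := hω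
  exact ⟨⟨y, ⟨i, le_trans (by exact_mod_cast hrs) hi⟩, hy⟩, ⟨y', ⟨i', le_trans (by exact_mod_cast hrs) hi'⟩, hy'⟩, hne⟩

/-! ## ¬ (crux without the disjointness clause) -/

/-- The crux event with the disjointness clause `0 ↮_H e` DROPPED (both arms only). -/
def E' (r : ℕ) : Set (BondConfig (Site 3)) :=
  {ω | (∃ y : Site 3, (∃ i : Fin 3, (r : ℤ) ≤ |y i|) ∧ ω ∈ openConnIn H 0 y) ∧
    (∃ y : Site 3, (∃ i : Fin 3, (r : ℤ) ≤ |y i - e i|) ∧ ω ∈ openConnIn H e y)}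

/-- `e ∈ H`. -/
theorem e_mem_H : e ∈ H := by simp [H, e]

/-- `0 ∼ e` in `ℤ³`. -/
theorem adj_zero_e : (zdGraph 3).Adj 0 e := by
  rw [zdGraph_adj_iff]; exact ⟨1, Or.inl (by simp [e])⟩

/-- `e ≠ 0`. -/
theorem e_ne_zero : e ≠ 0 := by
  intro h; have := congr_fun h 1; simp [e] at this

/-- `armBox (r+1) ∩ {edge 0e open} ⊆ E' r`: the arm from `0` serves both roots once the floor edge is open. -/
theorem armBox_inter_subset_E' (r : ℕ) :
    armBox (r + 1) ∩ {ω | s((0 : Site 3), e) ∈ ω} ⊆ E' r := by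
  rintro ω ⟨⟨a, ha, b, ⟨i, hi⟩, hω⟩, hoe⟩
  rw [Set.mem_singleton_iff] at ha
  subst ha
  have hωH : ω ∈ openConnIn H 0 b := openConnIn_mono' (halfBox_subset_H _) _ _ hω
  refine ⟨⟨b, ⟨i, by push_cast at hi; omega⟩, hωH⟩, ⟨b, ⟨i, ?_⟩, ?_⟩⟩
  · have h1 : |e i| ≤ 1 := by
      simp only [e]; rcases eq_or_ne i 1 with rfl | hi1
      · simp
      · simp [Pi.single_eq_of_ne hi1]
    have h2 : |b i| - |e i| ≤ |b i - e i| := abs_sub_abs_le_abs_sub _ _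
    push_cast at hi; omega
  · -- e → 0 (open floor edge) → b, inside H
    obtain ⟨h0, hb, hreach⟩ := hωH
    refine ⟨e_mem_H, hb, SimpleGraph.Reachable.trans ?_ hreach⟩
    refine SimpleGraph.Adj.reachable ?_
    show (openGraph ω).Adj e 0
    rw [openGraph_adj]
    exact ⟨by rw [Sym2.eq_swap]; exact hoe, e_ne_zero⟩

/-- **Disjointness is load-bearing**: without `0 ↮_H e` the crux is FALSE. Indeed
`P(E' r) ≥ p_c · P(armBox (r+1)) ≥ p_c / (36 (2r+3)²)` (Harris–FKG for the increasing events `armBox` and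
`{0e open}`, then `armBox_ge`), which is not `O(r^{-5/2-κ})`. The true exponent of `E'` is the boundary
one-arm exponent `x_s ≈ 0.975` (Deng–Blöte 2005); rigorously it is `≤ 2` (`quantitativeBGN_exponent_le_two`). -/
theorem boundaryTwoArmDecay_false_without_disjoint :
    ¬ (∃ κ C : ℝ, 0 < κ ∧ ∀ r : ℕ, 1 ≤ r → μ.real (E' r) ≤ C * (r : ℝ) ^ (-(5 / 2 + κ))) := by
  rintro ⟨κ, C, hκ, h⟩
  have hpc0 : 0 < ((criticalProbI 3 : unitInterval) : ℝ) :=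
    (Grimmett1999_criticalProb_pos_lt_one_holds 3 (by norm_num)).1
  set p : ℝ := ((criticalProbI 3 : unitInterval) : ℝ) with hp
  -- lower bound on P(E' r)
  have hlow : ∀ r : ℕ, p / (36 * (2 * ((r : ℝ) + 1) + 1) ^ 2) ≤ μ.real (E' r) := by
    intro r
    have hedge : s((0 : Site 3), e) ∈ (zdGraph 3).edgeSet := (SimpleGraph.mem_edgeSet _).2 adj_zero_e
    have hO : μ.real {ω : BondConfig (Site 3) | s((0 : Site 3), e) ∈ ω} = p :=
      bondPercolation_cylinder (zdGraph 3) (criticalProbI 3) hedge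
    have hBup : IsUpperSet ({ω | s((0 : Site 3), e) ∈ ω} : Set (BondConfig (Site 3))) :=
      fun ω ω' hle hω => hle hω
    have hfkg := harris_fkg_holds (zdGraph 3) (criticalProbI 3) (isUpperSet_openCrossing _ _ _)
      hBup (measurableSet_armBox (r + 1)) (measurableSet_mem _)
    have harm := armBox_ge (r + 1)
    calc p / (36 * (2 * ((r : ℝ) + 1) + 1) ^ 2) = 1 / (36 * (2 * ((r + 1 : ℕ) : ℝ) + 1) ^ 2) * p := by
          push_cast; ring
      _ ≤ μ.real (armBox (r + 1)) * μ.real {ω : BondConfig (Site 3) | s((0 : Site 3), e) ∈ ω} := by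
          rw [hO]; exact mul_le_mul_of_nonneg_right harm hpc0.le
      _ ≤ μ.real (armBox (r + 1) ∩ {ω | s((0 : Site 3), e) ∈ ω}) := hfkg
      _ ≤ μ.real (E' r) := measureReal_mono (armBox_inter_subset_E' r)
  -- pick r with r^{1/2+κ} > 900 |C| / p
  have hb : 0 < 1 / 2 + κ := by linarith
  obtain ⟨r, hr1, hr⟩ := exists_nat_rpow_gt hb (900 * |C| / p)
  have hr0 : (0 : ℝ) < r := by exact_mod_cast hr1
  have hr1' : (1 : ℝ) ≤ r := by exact_mod_cast hr1
  have hup := (hlow r).trans (h r hr1)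
  have hrpow_pos : 0 < (r : ℝ) ^ (-(5 / 2 + κ)) := Real.rpow_pos_of_pos hr0 _
  have hC : C * (r : ℝ) ^ (-(5 / 2 + κ)) ≤ |C| * (r : ℝ) ^ (-(5 / 2 + κ)) :=
    mul_le_mul_of_nonneg_right (le_abs_self C) hrpow_pos.le
  have h25 : (2 * ((r : ℝ) + 1) + 1) ^ 2 ≤ 25 * (r : ℝ) ^ (2 : ℝ) := by
    rw [Real.rpow_two]; nlinarith
  have hsplit : (r : ℝ) ^ (2 : ℝ) * (r : ℝ) ^ (-(5 / 2 + κ)) = ((r : ℝ) ^ (1 / 2 + κ))⁻¹ := by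
    rw [← Real.rpow_add hr0, ← Real.rpow_neg hr0.le]; congr 1; ring
  have hpow_pos : 0 < (r : ℝ) ^ (1 / 2 + κ) := Real.rpow_pos_of_pos hr0 _
  have key : p ≤ 900 * |C| * ((r : ℝ) ^ (1 / 2 + κ))⁻¹ := by
    have h1 := hup.trans hC
    rw [div_le_iff₀ (by positivity)] at h1
    calc p ≤ |C| * (r : ℝ) ^ (-(5 / 2 + κ)) * (36 * (2 * ((r : ℝ) + 1) + 1) ^ 2) := h1
      _ ≤ |C| * (r : ℝ) ^ (-(5 / 2 + κ)) * (36 * (25 * (r : ℝ) ^ (2 : ℝ))) := by gcongr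
      _ = 900 * |C| * ((r : ℝ) ^ (2 : ℝ) * (r : ℝ) ^ (-(5 / 2 + κ))) := by ring
      _ = 900 * |C| * ((r : ℝ) ^ (1 / 2 + κ))⁻¹ := by rw [hsplit]
  rw [← div_eq_mul_inv, le_div_iff₀ hpow_pos] at key
  -- key : p * r^{1/2+κ} ≤ 900 |C| ; hr : 900|C|/p < r^{1/2+κ}
  rw [div_lt_iff₀ hpc0] at hr
  linarith [mul_comm p ((r : ℝ) ^ (1 / 2 + κ))]

end

end Summit.CriticalPhenomena.PercolationContinuityZ3.Theorems.BoundaryTwoArmDecay.Negative
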